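import Literature.NumberTheory.EllipticCurves.Kato2004.IwasawaH1LayerEigenfunctionalTwistZetaTwoProofs
import HarnessLib

/-!
# Kato 2004, Thm. 12.5 (1) at `p = 2` for the PAIR `(z(f_W), z̃)`, `z̃` the odd-branch transport of an Euler system of a SECOND curve
# `A` along `u : T₂A ≃ T₂W`, in the finite-level eigenfunctional currency — from an ABSTRACT pair value law: the SAME layer
# eigenfunctional `w` that is non-zero on `proj_n y` takes on `proj_n ỹ` the value `ρ · w(proj_n y)` with `ρ` in a FINITE set
# `P ⊂ ℂ₂ˣ` (the hypothesis `hw` of `IwasawaH1Data.lengthAt_quotient_span_eq_of_layerFunctionals_finset`; THEOREMS ONLY)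

Topic `NumberTheory/EllipticCurves`, sub-directory `Kato2004` (namespace = path). THEOREMS ONLY (net debt 0). Cell `bsd-2adic`
(run/shared/lean/pub/bsd-2adic/), seat `bsd-2adic-addL2x` GEN 22 (crux stmt-BirchSwinnertonDyer-19098 `AdditiveRankZeroAtTwo`, child C4″
stmt-BirchSwinnertonDyer-22618; repair-census entry R-B85 (2): the ODD-BRANCH side of reading step T22 (b) of the descent sockets on the
(−2)-split-twist block). GENERIC form of `IwasawaH1LayerEigenfunctionalTwistZetaTwoProofs` (GEN 21, p748434; there `A = W^{(−1)}`, twist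
element `i`, levels `k ≥ 2`, the pair value law `embed_twistSum_mul_eq_embed_sum_mul` inlined): here the second curve `A`, the threshold
`k₀` of the levels `ℚ(μ_{2^k·∏ℓ})` on which `u` is equivariant, the complex shadow `sd` of the twist elements and the PAIR VALUE LAW with
its two constants are PARAMETERS, so that the (−1)-block (`k₀ = 2`, `sd = I`) and the (−2)-block (`k₀ = 3`, `sd = √2·I`, pair law
`embed_twistSum_mul_eq_embed_sum_mul_negTwo` of `ZetaBodyTwistPairValuesTwoNegTwoProofs`) are instances, and the layers below the
threshold (`n + 2 < k₀`, where `u_*` is not available) are simply excluded by the finite exceptional set `S`. HONEST FRAMING: BSD is not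
proved by any of this; nothing about Kato's Main Conjecture is asserted; the statement is CONDITIONAL on the two `ZetaBody` witnesses,
on the LINK `Λ(u_* y′) = (1 ⊗ s_m)·Λ′(y′)`, on the displayed pair value law, and on Rohrlich's finiteness for `f` at `2` in the kernel
shape `hR` (`PSRohrlichAtLevel.rohrlich_primePow_of_isNewformOf`).

## Statement (`exists_finsets_forall_layerEigenfunctional_twistLift_two_of_pairLaw`)

Data: `W/ℚ`, `A/ℚ` elliptic; witnesses `ZetaBody W 2 f ι κ Λ c d a A z x` (over Kato's datum: `(c,12A) = (d,12N) = 1`, `c ≡ d ≡ 1 (mod A)`,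
`c, d > 1`, `[a/A]⁻_f ≠ 0`) and `ZetaBody A 2 f′ ι κ′ Λ′ c d a′ A z′ x′`; `u : T₂A ≃ T₂W` continuous, equivariant on the levels `k ≥ k₀`,
LINKED to `(Λ, Λ′)` by `Λ_{k,r}(u_* y₁) = (1 ⊗ s)·Λ′_{k,r}(y₁)` for THE `s` with `ι(s) = sd` (`k ≥ k₀`; such `s` exist, `hsd`); the pair
value law `hpair` with constants `C_W, C_T ≠ 0`; `K` cyclotomic with topological generator `γ`; a pin `I`; `y` the lift of
`(Cor z_{n+2,∅})_n`, `ỹ` with `proj_n ỹ = Cor u_* z′_{n+2,∅}` for `n + 2 ≥ k₀` (`IwasawaH1Data.existsUnique_twistLift_of_zetaBody_two{,_three}`);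
Rohrlich `hR` for `f`. Conclusion: finite `S, P ⊂ ℂ₂`, `0 ∉ P`, such that every primitive EVEN `ℂ₂`-valued `χ` mod `2^m` with
`χ(γ₀) − 1 ∉ S` has a layer `n` and an additive `w : H¹(ℚ_n, T₂W) → ℂ₂`, `ℤ₂`-semilinear, `χ(γ₀)`-eigen for `conj_γ`, `χ(γ₀)^{2^n} = 1`,
`w(proj_n y) ≠ 0` AND `w(proj_n ỹ) = ρ·w(proj_n y)` for some `ρ ∈ P`.

## Argument (verbatim GEN 21, with the pair law abstract)

`w` is GEN 20's functional `Σ_b ψ(b)·J((1⊗σ_b)Λ_{n+2,∅}(res ·))` (`exists_layerEigenfunctional`); its value on `proj_n y` is `2·ι₂(ξ)`,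
`ξ = Σ_b ψ_F(b)σ_b x` (lift `ψ = ψ_F ∘ ι₂`), non-zero off Rohrlich's set (`sum_character_embed_sigma_ne_zero_of_rohrlich_two`); by the LINK and
(C4) for `A`, `Λ(u_* z′) = 1 ⊗ (s_M x′)`, so its value on `proj_n ỹ` is `2·ι₂(ξ′)`, `ξ′ = Σ_b ψ_F(b)σ_b(s_M x′)`. The pair value law:
`C_W·ι_M(ξ′) = C_T·ι_M(ξ)`. At a REFERENCE level `M₀ = 2^{B+2}` (`B ≥ 2`, `B ≥ k₀`, `B` above Rohrlich's bound) with a primitive even `ψ₀` and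
`ξ₀ ≠ 0` this reads `ι_{M₀}(ρ₀) = C_T/C_W` for `ρ₀ := ξ′₀/ξ₀ ∈ ℚ(ζ_{M₀})`, `ρ₀ ≠ 0`; at any level `M` with `M₀ ∣ M`, through a ring map
`τ : ℚ(ζ_{M₀}) → ℚ(ζ_M)` with `ι_M ∘ τ = ι_{M₀}` (`exists_ringHom_cyclotomicField_comp_eq`), `ξ′ = τ(ρ₀)·ξ` (`ι_M` injective). Hence
`w(proj_n ỹ) = ι₂(τρ₀)·w(proj_n y)` and `ι₂(τρ₀) = e(ρ₀)` for the field embedding `e = ι₂ ∘ τ : ℚ(ζ_{M₀}) → ℂ₂` — a root of `minpoly_ℚ(ρ₀)`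
in `ℂ₂`: `P` := these roots minus `0` (finite), `S := {ζ − 1 : ζ^{2^{B+2}} = 1}`.

References: K. Kato, Astérisque 295 (2004), Thm. 12.5 (1)(2) pp. 221–222, §13.8 p. 228, 13.5 (2) p. 227, Thm. 9.7, Thm. 6.6 (1)
[Kato2004Asterisque]; D. Rohrlich, Invent. Math. 75 (1984) [RohrlichInventiones1984]; L. C. Washington, *Introduction to Cyclotomic Fields*
§13.1, Ch. 2 [Washington1997]; B. Mazur, J. Tate, J. Teitelbaum, Invent. Math. 84 (1986) §I.13 [MazurTateTeitelbaum1986Invent]; K. Rubin,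
*Euler Systems* (2000) Remark 2.1.4, Ch. VI [Rubin2000].
-/

set_option autoImplicit false

noncomputable section

open scoped BigOperators NumberField TensorProduct MatrixGroups
open Field IsDedekindDomain CongruenceSubgroup Polynomial
open Literature.NumberTheory.GaloisRepresentations
open Literature.NumberTheory.EllipticCurves Literature.NumberTheory.EllipticCurves.ModularForms
open Literature.NumberTheory.EllipticCurves.Kato2004.EulerSystemValues Rat.HeightOneSpectrum

namespace Literature.NumberTheory.EllipticCurves.Kato2004

/-! ## §1 From the `cycSubgroup`s of level `k ≥ k₀` to the levels `(n + 2, ∅)` with `n + 2 ≥ k₀` -/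

section Levels

variable (W : WeierstrassCurve ℚ) (A' : WeierstrassCurve ℚ) (u : A'.tateModule 2 ≃ₗ[ℤ_[2]] W.tateModule 2) {k₀ : ℕ}

/-- **From the level groups `cycSubgroup 2 k r` (`k ≥ k₀`) to the levels `(n + 2, ∅)` with `k₀ ≤ n + 2` of `cyclotomicLevelsRat 2 S`**: the
two are the same subgroup `Gal(ℚ̄/ℚ(μ_{2^{n+2}}))` (`cycSubgroup_eq_level`). The threshold form of `equivariant_level_of_cycSubgroup` (`k₀ = 2`)
and `equivariant_level_of_cycSubgroup_three` (`k₀ = 3`). [cite: Rubin2000, Remark 2.1.4] -/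
theorem equivariant_level_of_cycSubgroup_le
    (hV : ∀ k : ℕ, k₀ ≤ k → ∀ (r : Finset (HeightOneSpectrum (𝓞 ℚ))) (σ : absoluteGaloisGroup ℚ),
      σ ∈ cycSubgroup 2 k r → ∀ x : A'.tateModule 2, u (σ • x) = σ • u x)
    (S : Set (HeightOneSpectrum (𝓞 ℚ))) (n : ℕ) (hn : k₀ ≤ n + 2) :
    ∀ σ : absoluteGaloisGroup ℚ, σ ∈ (cyclotomicLevelsRat 2 S).level (n + 2) ∅ →
      ∀ x : A'.tateModule 2, u (σ • x) = σ • u x :=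
  fun σ hσ x ↦ hV (n + 2) hn ∅ σ (by rw [cycSubgroup_eq_level 2 S (n + 2) ∅]; exact hσ) x

end Levels

/-! ## §2 The assembly at `p = 2`, pair value law abstract -/


section Assembly

variable {W : WeierstrassCurve ℚ} [W.IsElliptic] [ContinuousSMul ℤ_[2] (W.tateModule 2)]
  [Module.Free ℤ_[2] (W.tateModule 2)] [Module.Finite ℤ_[2] (W.tateModule 2)]
  {A' : WeierstrassCurve ℚ} [A'.IsElliptic] [ContinuousSMul ℤ_[2] (A'.tateModule 2)]
  [Module.Free ℤ_[2] (A'.tateModule 2)] [Module.Finite ℤ_[2] (A'.tateModule 2)]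
  {N N' : ℕ} [NeZero N]
  {f : CuspForm (Gamma0 N) 2} {f' : CuspForm (Gamma0 N') 2} {ι : (m : ℕ) → (CyclotomicField m ℚ →+* ℂ)} {κ κ' : ℝ}
  {Λ : ∀ (k : ℕ) (r : Finset (HeightOneSpectrum (𝓞 ℚ))),
    H1 (tateRep W 2) (cycSubgroup 2 k r) →ₗ[ℤ_[2]] ℚ_[2] ⊗[ℚ] CyclotomicField (cycLevel 2 k r) ℚ}
  {Λ' : ∀ (k : ℕ) (r : Finset (HeightOneSpectrum (𝓞 ℚ))),
    H1 (tateRep A' 2) (cycSubgroup 2 k r) →ₗ[ℤ_[2]] ℚ_[2] ⊗[ℚ] CyclotomicField (cycLevel 2 k r) ℚ}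
  {c d a a' : ℤ} {A : ℕ}
  {z : ∀ (k : ℕ) (r : (cyclotomicLevelsRat 2 (badPlaces c d A N)).Ideals),
    H1 (tateRep W 2) ((cyclotomicLevelsRat 2 (badPlaces c d A N)).level k r.1)}
  {x : ∀ (k : ℕ) (r : (cyclotomicLevelsRat 2 (badPlaces c d A N)).Ideals), CyclotomicField (cycLevel 2 k r.1) ℚ}
  {z' : ∀ (k : ℕ) (r : (cyclotomicLevelsRat 2 (badPlaces c d A N')).Ideals),
    H1 (tateRep A' 2) ((cyclotomicLevelsRat 2 (badPlaces c d A N')).level k r.1)}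
  {x' : ∀ (k : ℕ) (r : (cyclotomicLevelsRat 2 (badPlaces c d A N')).Ideals), CyclotomicField (cycLevel 2 k r.1) ℚ}
  {K : ZpExtension ℚ 2} {γ : absoluteGaloisGroup ℚ} {I : IwasawaH1Data W 2 K γ}
  (u : A'.tateModule 2 ≃ₗ[ℤ_[2]] W.tateModule 2) (hu : Continuous u) {k₀ : ℕ}
  (hV : ∀ k : ℕ, k₀ ≤ k → ∀ (r : Finset (HeightOneSpectrum (𝓞 ℚ))) (σ : absoluteGaloisGroup ℚ),
    σ ∈ cycSubgroup 2 k r → ∀ t : A'.tateModule 2, u (σ • t) = σ • u t)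

/-- `4 ∣ 2^{n+2}`. [folklore] -/
private theorem four_dvd_cycLevel (n : ℕ) : 4 ∣ cycLevel 2 (n + 2) ∅ := by
  have hM : cycLevel 2 (n + 2) ∅ = 2 ^ (n + 2) := by simp [cycLevel]
  rw [hM, pow_add]
  exact Dvd.intro_left _ rfl

set_option backward.isDefEq.respectTransparency false in
set_option maxHeartbeats 800000 in
-- the assembly is long (two `ZetaBody` packages, GEN 20's construction, the reference level and the transport of the ratio)
/-- **Kato Thm. 12.5 (1) at `p = 2` for the pair `(y, ỹ)`, finite-level eigenfunctional form, from an ABSTRACT pair value law** — the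
hypothesis `hw` of `IwasawaH1Data.lengthAt_quotient_span_eq_of_layerFunctionals_finset` as a theorem. Data as in the module docstring: a
`ZetaBody` witness of `W` over Kato's datum and one of a second curve `A` over the same `(c, d, A)`; an identification `u : T₂A ≃ T₂W`
continuous and equivariant on the levels `k ≥ k₀`, LINKED to `(Λ, Λ′)` through the twist elements `s` with `ι(s) = sd` (which exist from
the level `k₀` on, `hsd`); the PAIR VALUE LAW `hpair`: `C_W·ι(Σ_b ψ(b)σ_b(s·x′_{n+2,∅})) = C_T·ι(Σ_b ψ(b)σ_b x_{n+2,∅})` for every level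
`n + 2 ≥ k₀` and every even `ψ`, with level-independent constants `C_W, C_T ≠ 0`; `K` cyclotomic with topological generator `γ`, a pin `I`,
the lifts `y` of `(Cor z_{n+2,∅})_n` and `ỹ` with `proj_n ỹ = Cor u_* z′_{n+2,∅}` for `n + 2 ≥ k₀`; Rohrlich `hR` for `f` at `2`. Conclusion:
finite `S, P ⊂ ℂ₂` with `0 ∉ P` such that every primitive even `ℂ₂`-valued `χ` mod `2^m` (`m > 0`) with `χ(γ₀) − 1 ∉ S` admits a layer
`n` and an additive `w : H¹(ℚ_n, T₂W) → ℂ₂`, `ℤ₂`-semilinear, a `χ(γ₀)`-eigenfunctional for `conj_γ`, with `χ(γ₀)^{2^n} = 1`,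
`w(proj_n y) ≠ 0`, and `w(proj_n ỹ) = ρ·w(proj_n y)` for some `ρ ∈ P`. Instances: `A = W^{(−1)}` (`k₀ = 2`, `sd = I`:
`exists_finsets_forall_layerEigenfunctional_twistLift_two`) and `A = W^{(−2)}` (`k₀ = 3`, `sd = √2·I`, pair law
`embed_twistSum_mul_eq_embed_sum_mul_negTwo`). [cite: Kato2004Asterisque, Thm. 12.5 (1)(2) (pp. 221–222), §13.8 (p. 228), 13.5 (2) (p. 227)]
[cite: MazurTateTeitelbaum1986Invent, §I.13] [cite: Washington1997, §13.1] -/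
theorem exists_finsets_forall_layerEigenfunctional_twistLift_two_of_pairLaw (hbody : ZetaBody W 2 f ι κ Λ c d a A z x)
    (hbody' : ZetaBody A' 2 f' ι κ' Λ' c d a' A z' x')
    (hf : IsNewformOf W f) (hκ : κ ≠ 0) (hA : 0 < A)
    (hc : Int.gcd c (6 * 2 * A) = 1) (hd : Int.gcd d (6 * 2 * N) = 1)
    (hcA : (A : ℤ) ∣ c - 1) (hdA : (A : ℤ) ∣ d - 1) (hc1 : 1 < c) (hd1 : 1 < d)
    (ha : ratMinusSymbol f ((a : ℚ) / A) ≠ 0)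
    (sd CW CT : ℂ) (hCW0 : CW ≠ 0) (hCT0 : CT ≠ 0)
    (hsd : ∀ n : ℕ, k₀ ≤ n + 2 → ∃ s : CyclotomicField (cycLevel 2 (n + 2) ∅) ℚ, ι (cycLevel 2 (n + 2) ∅) s = sd)
    (hpair : ∀ (n : ℕ), k₀ ≤ n + 2 → ∀ {s : CyclotomicField (cycLevel 2 (n + 2) ∅) ℚ}, ι (cycLevel 2 (n + 2) ∅) s = sd →
      ∀ (ψ : DirichletCharacter (CyclotomicField (cycLevel 2 (n + 2) ∅) ℚ) (cycLevel 2 (n + 2) ∅)), ψ.Even →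
      ∀ (xT : CyclotomicField (cycLevel 2 (n + 2) ∅) ℚ), xT = x' (n + 2) (cyclotomicLevelsRat 2 (badPlaces c d A N')).idealOne →
        CW * ι (cycLevel 2 (n + 2) ∅) (∑ b : (ZMod (cycLevel 2 (n + 2) ∅))ˣ, ψ (b : ZMod (cycLevel 2 (n + 2) ∅)) *
            sigma (cycLevel 2 (n + 2) ∅) b (s * xT)) =
          CT * ι (cycLevel 2 (n + 2) ∅) (∑ b : (ZMod (cycLevel 2 (n + 2) ∅))ˣ, ψ (b : ZMod (cycLevel 2 (n + 2) ∅)) *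
            sigma (cycLevel 2 (n + 2) ∅) b (x (n + 2) (cyclotomicLevelsRat 2 (badPlaces c d A N)).idealOne)))
    (hlink : ∀ (k : ℕ) (hk : k₀ ≤ k) (r : Finset (HeightOneSpectrum (𝓞 ℚ))) (s : CyclotomicField (cycLevel 2 k r) ℚ),
      ι (cycLevel 2 k r) s = sd →
      ∀ y₁ : H1 (tateRep A' 2) (cycSubgroup 2 k r),
        Λ k r (twistH1On W A' u hu (hV k hk r) y₁) = ((1 : ℚ_[2]) ⊗ₜ[ℚ] s) * Λ' k r y₁)
    (hK : K.IsCyclotomic) (hγ : K.IsTopGenerator γ)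
    {y : I.H} (hy : ∀ n : ℕ, I.proj n y = levelToLayerTwo W hK (badPlaces c d A N) n
      (z (n + 2) (cyclotomicLevelsRat 2 (badPlaces c d A N)).idealOne))
    {y' : I.H} (hy' : ∀ (n : ℕ) (hn : k₀ ≤ n + 2), I.proj n y' = levelToLayerTwo W hK (badPlaces c d A N') n
      (twistH1On W A' u hu
        (equivariant_level_of_cycSubgroup_le W A' u hV (badPlaces c d A N') n hn)
        (z' (n + 2) (cyclotomicLevelsRat 2 (badPlaces c d A N')).idealOne)))
    (hR : Set.Finite {χ : Σ m : ℕ, DirichletCharacter ℂ m |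
        χ.1 ≠ 0 ∧ χ.1.primeFactors ⊆ {2} ∧ χ.2.IsPrimitive ∧
          ∃ L : ℂ → ℂ, Differentiable ℂ L ∧
            (∀ s : ℂ, 2 < s.re → L s = twistedLSeries f χ.2 s) ∧ L 1 = 0}) :
    ∃ (S P : Finset ℂ_[2]), (0 : ℂ_[2]) ∉ P ∧
      ∀ m : ℕ, 0 < m → ∀ χ : DirichletCharacter ℂ_[2] (2 ^ m), χ.IsPrimitive → χ.Even →
      (χ (cyclotomicGenerator 2 : ZMod (2 ^ m)) - 1) ∉ S →
      ∃ (n : ℕ) (w : H1 (tateRep W 2) (K.layerSubgroup n) →+ ℂ_[2]),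
        χ (cyclotomicGenerator 2 : ZMod (2 ^ m)) ^ 2 ^ n = 1 ∧
        (∀ (e : ℤ_[2]) (v : H1 (tateRep W 2) (K.layerSubgroup n)),
          w (e • v) = ((algebraMap ℚ_[2] ℂ_[2]).comp (algebraMap ℤ_[2] ℚ_[2])) e * w v) ∧
        (∀ v : H1 (tateRep W 2) (K.layerSubgroup n),
          w ((conjMap (tateRep W 2).toTopRep (K.layerSubgroup n) γ 1).hom.toLinearMap v) =
            χ (cyclotomicGenerator 2 : ZMod (2 ^ m)) * w v) ∧
        w (I.proj n y) ≠ 0 ∧ ∃ ρ ∈ P, w (I.proj n y') = ρ * w (I.proj n y) := by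
  classical
  -- Rohrlich's exceptional levels are bounded by some `B₀`; take `B ≥ 2` with `k₀ ≤ B` (the threshold of `u`)
  obtain ⟨B₀, hB₀⟩ := (hR.image Sigma.fst).bddAbove
  set B : ℕ := max B₀ (max 2 k₀) with hBdef
  have hB : ∀ χ : (Σ m : ℕ, DirichletCharacter ℂ m), χ ∈ {χ : Σ m : ℕ, DirichletCharacter ℂ m |
      χ.1 ≠ 0 ∧ χ.1.primeFactors ⊆ {2} ∧ χ.2.IsPrimitive ∧
        ∃ L : ℂ → ℂ, Differentiable ℂ L ∧
          (∀ s : ℂ, 2 < s.re → L s = twistedLSeries f χ.2 s) ∧ L 1 = 0} → χ.1 ≤ B :=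
    fun χ hχ ↦ (hB₀ ⟨χ, hχ, rfl⟩).trans (le_max_left _ _)
  have hB2 : 2 ≤ B := (le_max_left 2 k₀).trans (le_max_right _ _)
  have hBk : k₀ ≤ B := (le_max_right 2 k₀).trans (le_max_right _ _)
  /- ### the REFERENCE level `n₀ := B`, `M₀ = 2^{B+2}` -/
  have hM₀ : cycLevel 2 (B + 2) ∅ = 2 ^ (B + 2) := by simp [cycLevel]
  have hBn₀ : B < 2 ^ (B + 2) := lt_of_lt_of_le (by omega) (Nat.lt_pow_self one_lt_two).le
  have h4₀ : 4 ∣ cycLevel 2 (B + 2) ∅ := four_dvd_cycLevel B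
  -- a primitive even `ℚ(ζ_{M₀})`-valued character `ψ₀`
  have hζ₀ := IsCyclotomicExtension.zeta_spec (cycLevel 2 (B + 2) ∅) ℚ (CyclotomicField (cycLevel 2 (B + 2) ∅) ℚ)
  have hη₀ : IsPrimitiveRoot (IsCyclotomicExtension.zeta (cycLevel 2 (B + 2) ∅) ℚ
      (CyclotomicField (cycLevel 2 (B + 2) ∅) ℚ) ^ 4) (2 ^ B) := by
    have h := hζ₀.pow_of_dvd (p := 4) (by norm_num) h4₀
    have hdiv : cycLevel 2 (B + 2) ∅ / 4 = 2 ^ B := by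
      rw [hM₀, pow_add, show (2 : ℕ) ^ 2 = 4 by norm_num, Nat.mul_div_cancel _ (by norm_num : 0 < 4)]
    rwa [hdiv] at h
  obtain ⟨ψ₀, hψ₀e, hψ₀p⟩ := LayerCharacterTwo.exists_even_isPrimitive (S := CyclotomicField (cycLevel 2 (B + 2) ∅) ℚ)
    (show 1 ≤ B by omega) (M := cycLevel 2 (B + 2) ∅) hM₀ hη₀
  -- a `2`-adic embedding of `ℚ(ζ_{M₀})`; `ξ₀ ≠ 0` by GEN 20's non-vanishing
  haveI : Module.IsTorsionFree ℚ (CyclotomicField (cycLevel 2 (B + 2) ∅) ℚ) := DivisionSemiring.to_moduleIsTorsionFree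
  haveI : Module.IsTorsionFree ℚ ℂ_[2] := DivisionSemiring.to_moduleIsTorsionFree
  let ι₂r : CyclotomicField (cycLevel 2 (B + 2) ∅) ℚ →+* ℂ_[2] :=
    (IsAlgClosed.lift (R := ℚ) (M := ℂ_[2]) (S := CyclotomicField (cycLevel 2 (B + 2) ∅) ℚ)).toRingHom
  have hψ₀Ce : DirichletCharacter.Even (ψ₀.ringHomComp ι₂r) :=
    (LayerCharacterTwo.even_ringHomComp_iff ψ₀ ι₂r.injective).mpr hψ₀e
  have hψ₀Cp : DirichletCharacter.IsPrimitive (ψ₀.ringHomComp ι₂r) :=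
    (LayerCharacterTwo.isPrimitive_ringHomComp_iff ψ₀ ι₂r.injective).mpr hψ₀p
  set ξ₀ : CyclotomicField (cycLevel 2 (B + 2) ∅) ℚ := ∑ b : (ZMod (cycLevel 2 (B + 2) ∅))ˣ,
    ψ₀ (b : ZMod (cycLevel 2 (B + 2) ∅)) * sigma (cycLevel 2 (B + 2) ∅) b
      (x (B + 2) (cyclotomicLevelsRat 2 (badPlaces c d A N)).idealOne) with hξ₀def
  have hξ₀ : ξ₀ ≠ 0 := by
    intro h0
    have hne := sum_character_embed_sigma_ne_zero_of_rohrlich_two hbody hf hκ hA hc hd hcA hdA hc1 hd1 ha hB B hBn₀ ι₂r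
      (ψ₀.ringHomComp ι₂r) hψ₀Ce hψ₀Cp
    apply hne
    have : ∑ b : (ZMod (cycLevel 2 (B + 2) ∅))ˣ, (ψ₀.ringHomComp ι₂r) (b : ZMod (cycLevel 2 (B + 2) ∅)) *
        ι₂r (sigma (cycLevel 2 (B + 2) ∅) b (x (B + 2) (cyclotomicLevelsRat 2 (badPlaces c d A N)).idealOne)) = ι₂r ξ₀ := by
      rw [hξ₀def, map_sum]
      refine Finset.sum_congr rfl fun b _ ↦ ?_
      rw [map_mul, MulChar.ringHomComp_apply]
    rw [this, h0, map_zero]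
  -- the twist element at the reference level and `ξ′₀`
  obtain ⟨i₀, hi₀⟩ := hsd B (by omega)
  obtain ⟨xT₀, hxT₀⟩ : ∃ t : CyclotomicField (cycLevel 2 (B + 2) ∅) ℚ,
      t = x' (B + 2) (cyclotomicLevelsRat 2 (badPlaces c d A N')).idealOne := ⟨_, rfl⟩
  set ξ₀' : CyclotomicField (cycLevel 2 (B + 2) ∅) ℚ := ∑ b : (ZMod (cycLevel 2 (B + 2) ∅))ˣ,
    ψ₀ (b : ZMod (cycLevel 2 (B + 2) ∅)) * sigma (cycLevel 2 (B + 2) ∅) b (i₀ * xT₀) with hξ₀'def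
  have hval₀ : CW * ι (cycLevel 2 (B + 2) ∅) ξ₀' = CT * ι (cycLevel 2 (B + 2) ∅) ξ₀ :=
    hpair B (by omega) hi₀ ψ₀ hψ₀e xT₀ hxT₀
  have hξ₀' : ξ₀' ≠ 0 := by
    intro h0
    rw [h0, map_zero, mul_zero] at hval₀
    exact mul_ne_zero hCT0 ((map_ne_zero_iff _ (ι (cycLevel 2 (B + 2) ∅)).injective).mpr hξ₀) hval₀.symm
  set ρ₀ : CyclotomicField (cycLevel 2 (B + 2) ∅) ℚ := ξ₀' / ξ₀ with hρ₀def
  have hρ₀ : ρ₀ ≠ 0 := div_ne_zero hξ₀' hξ₀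
  have hιρ₀ : ι (cycLevel 2 (B + 2) ∅) ρ₀ * CW = CT := by
    have hιξ₀ : ι (cycLevel 2 (B + 2) ∅) ξ₀ ≠ 0 := (map_ne_zero_iff _ (ι (cycLevel 2 (B + 2) ∅)).injective).mpr hξ₀
    rw [hρ₀def, map_div₀]
    field_simp
    linear_combination hval₀
  -- the finite set of `2`-adic shadows of `ρ₀`: the roots of its minimal polynomial in `ℂ₂`, `0` removed
  set P : Finset ℂ_[2] := ((minpoly ℚ ρ₀).aroots ℂ_[2]).toFinset.erase 0 with hPdef
  have hPmem : ∀ e : CyclotomicField (cycLevel 2 (B + 2) ∅) ℚ →+* ℂ_[2], e ρ₀ ∈ P := by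
    intro e
    rw [hPdef, Finset.mem_erase, Multiset.mem_toFinset, mem_aroots]
    refine ⟨(map_ne_zero_iff _ e.injective).mpr hρ₀, minpoly.ne_zero_of_finite ℚ ρ₀, ?_⟩
    have h := aeval_algHom_apply e.toRatAlgHom ρ₀ (minpoly ℚ ρ₀)
    rw [minpoly.aeval, map_zero, RingHom.toRatAlgHom_apply] at h
    exact h
  -- the exceptional set: `ζ - 1` for `ζ^{2^{B+2}} = 1`
  refine ⟨(Polynomial.nthRootsFinset (2 ^ (B + 2)) (1 : ℂ_[2])).image (fun ζ ↦ ζ - 1), P, Finset.notMem_erase _ _, ?_⟩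
  intro m hm χ hχp hχe hχS
  -- `m > B + 2` (a character mod `2^m`, `m ≤ B + 2`, has `χ(γ₀)^{2^{B+2}} = 1`)
  have hmB : B + 2 < m := by
    by_contra hle
    rw [not_lt] at hle
    apply hχS
    rw [Finset.mem_image]
    refine ⟨χ (cyclotomicGenerator 2 : ZMod (2 ^ m)), ?_, rfl⟩
    rw [Polynomial.mem_nthRootsFinset (pow_pos two_pos (B + 2))]
    haveI : NeZero (2 ^ m) := ⟨pow_ne_zero _ two_ne_zero⟩
    have hcop : Nat.Coprime (cyclotomicGenerator 2) (2 ^ m) := by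
      rw [cyclotomicGenerator_two]; exact Nat.Coprime.pow_right _ (by norm_num)
    have hu' := ZMod.pow_totient (ZMod.unitOfCoprime _ hcop)
    rw [Nat.totient_prime_pow Nat.prime_two hm] at hu'
    have hdvd : 2 ^ (m - 1) * (2 - 1) ∣ 2 ^ (B + 2) := by
      rw [show (2 - 1 : ℕ) = 1 from rfl, mul_one]; exact pow_dvd_pow 2 (by omega)
    obtain ⟨q, hq⟩ := hdvd
    rw [← ZMod.coe_unitOfCoprime _ hcop, ← map_pow, ← Units.val_pow_eq_pow_val, hq, pow_mul, hu', one_pow,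
      Units.val_one, map_one]
  obtain ⟨n, rfl⟩ : ∃ n, m = n + 2 := ⟨m - 2, by omega⟩
  have hkn : k₀ ≤ n + 2 := by omega
  have hBn : B < 2 ^ (n + 2) := lt_of_lt_of_le (by omega) (Nat.lt_pow_self one_lt_two).le
  have hM : cycLevel 2 (n + 2) ∅ = 2 ^ (n + 2) := by simp [cycLevel]
  have hdvd : 2 ^ (n + 2) ∣ cycLevel 2 (n + 2) ∅ := ⟨1, by rw [hM, mul_one]⟩
  have hdvd₀ : cycLevel 2 (B + 2) ∅ ∣ cycLevel 2 (n + 2) ∅ := by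
    rw [hM₀, hM]; exact pow_dvd_pow 2 (by omega)
  -- transport `χ` to the level `cycLevel 2 (n+2) ∅` of the witness
  set χ' : DirichletCharacter ℂ_[2] (cycLevel 2 (n + 2) ∅) := DirichletCharacter.changeLevel hdvd χ with hχ'
  have hcast : ∀ b : (ZMod (cycLevel 2 (n + 2) ∅))ˣ,
      χ' (b : ZMod (cycLevel 2 (n + 2) ∅)) = χ (ZMod.cast (b : ZMod (cycLevel 2 (n + 2) ∅)) : ZMod (2 ^ (n + 2))) := by
    intro b
    rw [hχ', DirichletCharacter.changeLevel_eq_cast_of_dvd χ hdvd b]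
  have hχ'e : χ'.Even := by
    change χ' (-1) = 1
    rw [← Units.coe_neg_one, hcast, Units.coe_neg_one, ZMod.cast_neg hdvd, ZMod.cast_one hdvd]
    exact hχe
  have hχp' : χ.conductor = 2 ^ (n + 2) := hχp
  have hχ'p : χ'.IsPrimitive := by
    rw [DirichletCharacter.isPrimitive_def, hχ', DirichletCharacter.conductor_changeLevel χ hdvd, hχp', hM]
  -- `g = 5` and `u = χ_cyc(γ)` at level `M`
  obtain ⟨g, hg⟩ := LayerCharacterTwo.exists_unit_eq_five (n := n) hM
  have hχ'g : χ' (g : ZMod (cycLevel 2 (n + 2) ∅)) = χ (cyclotomicGenerator 2 : ZMod (2 ^ (n + 2))) := by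
    rw [hcast, hg, cyclotomicGenerator_two]
    rw [show (5 : ZMod (cycLevel 2 (n + 2) ∅)) = ((5 : ℕ) : ZMod (cycLevel 2 (n + 2) ∅)) by norm_cast,
      ZMod.cast_natCast hdvd]
  have hgenu := hK.exists_eq_pow_or_eq_neg_pow_of_isTopGenerator_two hγ n hM
  obtain ⟨t, ht⟩ := hgenu g
  obtain ⟨t', -, ht'⟩ := LayerCharacterTwo.exists_eq_five_pow_or_eq_neg_five_pow hM hg
    (modNCyclotomicCharacter ℚ (cycLevel 2 (n + 2) ∅) γ)
  have hval_g : χ' (g : ZMod (cycLevel 2 (n + 2) ∅)) =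
      χ' ((modNCyclotomicCharacter ℚ (cycLevel 2 (n + 2) ∅) γ : (ZMod (cycLevel 2 (n + 2) ∅))ˣ) :
        ZMod (cycLevel 2 (n + 2) ∅)) ^ t := by
    have : χ' ((modNCyclotomicCharacter ℚ (cycLevel 2 (n + 2) ∅) γ ^ t : (ZMod (cycLevel 2 (n + 2) ∅))ˣ) :
        ZMod _) = χ' ((modNCyclotomicCharacter ℚ (cycLevel 2 (n + 2) ∅) γ : (ZMod (cycLevel 2 (n + 2) ∅))ˣ) :
        ZMod _) ^ t := by
      rw [Units.val_pow_eq_pow_val, map_pow]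
    rcases ht with h | h
    · rw [h]; exact this
    · rw [h, Units.val_neg, hχ'e.eval_neg]; exact this
  have hval_u : χ' ((modNCyclotomicCharacter ℚ (cycLevel 2 (n + 2) ∅) γ : (ZMod (cycLevel 2 (n + 2) ∅))ˣ) :
        ZMod (cycLevel 2 (n + 2) ∅)) = χ' (g : ZMod (cycLevel 2 (n + 2) ∅)) ^ t' := by
    have : χ' ((g ^ t' : (ZMod (cycLevel 2 (n + 2) ∅))ˣ) : ZMod _) = χ' (g : ZMod _) ^ t' := by
      rw [Units.val_pow_eq_pow_val, map_pow]
    rcases ht' with h | h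
    · rw [h]; exact this
    · rw [h, Units.val_neg, hχ'e.eval_neg]; exact this
  -- the finite order of `χ'`
  have hfin : ∃ o : ℕ, 0 < o ∧ χ' ^ o = 1 := by
    refine ⟨Fintype.card (ZMod (cycLevel 2 (n + 2) ∅))ˣ, Fintype.card_pos, MulChar.ext fun b ↦ ?_⟩
    rw [MulChar.pow_apply_coe, MulChar.one_apply_coe, ← map_pow, ← Units.val_pow_eq_pow_val, pow_card_eq_one,
      Units.val_one, map_one]
  obtain ⟨o, ho, hχo⟩ := hfin
  have hgo : χ' (g : ZMod (cycLevel 2 (n + 2) ∅)) ^ o = 1 := by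
    rw [← MulChar.pow_apply_coe, hχo, MulChar.one_apply_coe]
  -- `ψ := (χ'^t)⁻¹`
  set ψ : DirichletCharacter ℂ_[2] (cycLevel 2 (n + 2) ∅) := (χ' ^ t)⁻¹ with hψ
  have hψe : ψ.Even := even_inv (LayerCharacterTwo.even_pow hχ'e t)
  have hψu : ψ ((modNCyclotomicCharacter ℚ (cycLevel 2 (n + 2) ∅) γ : (ZMod (cycLevel 2 (n + 2) ∅))ˣ) :
      ZMod (cycLevel 2 (n + 2) ∅)) = (χ (cyclotomicGenerator 2 : ZMod (2 ^ (n + 2))))⁻¹ := by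
    rw [hψ, MulChar.inv_apply_eq_inv', MulChar.pow_apply_coe, ← hval_g, hχ'g]
  -- `ψ` is primitive: `ψ = χ'^{t(o-1)}` and `χ' = ψ^{t'(o-1)}`
  have hb : χ' ^ (t * (o - 1)) = ψ := by
    rw [hψ]
    refine eq_inv_of_mul_eq_one_left ?_
    rw [← pow_add, show t * (o - 1) + t = t * o by
        rw [Nat.mul_sub_one, Nat.sub_add_cancel (Nat.le_mul_of_pos_right t ho)],
      pow_mul', hχo, one_pow]
  have ha'' : ψ ^ (t' * (o - 1)) = χ' := by
    refine eq_of_even_of_apply_eq_of_forall_eq_pow_or hgenu (LayerCharacterTwo.even_pow hψe _) hχ'e ?_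
    rw [MulChar.pow_apply_coe, hψu, hval_u, hχ'g, inv_pow]
    have h1 : χ (cyclotomicGenerator 2 : ZMod (2 ^ (n + 2))) ^ (t' * (o - 1)) *
        χ (cyclotomicGenerator 2 : ZMod (2 ^ (n + 2))) ^ t' = 1 := by
      rw [← pow_add, show t' * (o - 1) + t' = t' * o by
        rw [Nat.mul_sub_one, Nat.sub_add_cancel (Nat.le_mul_of_pos_right t' ho)], pow_mul', ← hχ'g, hgo, one_pow]
    exact inv_eq_of_mul_eq_one_right h1
  have hψp : ψ.IsPrimitive := LayerCharacterTwo.isPrimitive_of_pow_eq_of_pow_eq hχ'p ha'' hb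
  -- a `2`-adic embedding of `ℚ(ζ_M)` and the functional
  haveI : Module.IsTorsionFree ℚ (CyclotomicField (cycLevel 2 (n + 2) ∅) ℚ) := DivisionSemiring.to_moduleIsTorsionFree
  let ι₂ : CyclotomicField (cycLevel 2 (n + 2) ∅) ℚ →+* ℂ_[2] :=
    (IsAlgClosed.lift (R := ℚ) (M := ℂ_[2]) (S := CyclotomicField (cycLevel 2 (n + 2) ∅) ℚ)).toRingHom
  have hle : cycSubgroup 2 (n + 2) ∅ ≤ K.layerSubgroup n := hK.cyclotomicLevelsRat_level_le_layerSubgroup_two (badPlaces c d A N) n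
  letI : Fintype (K.layerSubgroup n ⧸ (cycSubgroup 2 (n + 2) ∅).subgroupOf (K.layerSubgroup n)) := Fintype.ofFinite _
  obtain ⟨w, hw1, hw2, hw3⟩ := exists_layerEigenfunctional (W := W) (p := 2) (U := K.layerSubgroup n) (n + 2)
    hle (Λ (n + 2) ∅) (hbody.2.2.1 (n + 2) ∅) ι₂ ψ
  have hχU : ∀ σ ∈ K.layerSubgroup n,
      ψ ((modNCyclotomicCharacter ℚ (cycLevel 2 (n + 2) ∅) σ : (ZMod (cycLevel 2 (n + 2) ∅))ˣ) :
        ZMod (cycLevel 2 (n + 2) ∅)) = 1 :=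
    fun σ hσ ↦ hK.dirichletCharacter_apply_eq_one_of_mem_layerSubgroup_two n hM ψ hψe hσ
  -- lift `ψ` to `ℚ(ζ_M)`: `ψ = ψ_F ∘ ι₂`
  have hcard : Fintype.card (ZMod (cycLevel 2 (n + 2) ∅))ˣ ∣ cycLevel 2 (n + 2) ∅ := by
    rw [ZMod.card_units_eq_totient, hM, Nat.totient_prime_pow Nat.prime_two (by omega), show n + 2 - 1 = n + 1 from rfl]
    exact ⟨2, by ring⟩
  have he : ∀ b : (ZMod (cycLevel 2 (n + 2) ∅))ˣ, b ^ cycLevel 2 (n + 2) ∅ = 1 := fun b ↦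
    orderOf_dvd_iff_pow_eq_one.mp (dvd_trans (orderOf_dvd_card) hcard)
  obtain ⟨ψF, hψF⟩ := LayerCharacterTwo.exists_ringHomComp_eq (N := cycLevel 2 (n + 2) ∅) ι₂.injective
    (IsCyclotomicExtension.zeta_spec (cycLevel 2 (n + 2) ∅) ℚ (CyclotomicField (cycLevel 2 (n + 2) ∅) ℚ)) he ψ
  have hψFe : ψF.Even := by rw [← LayerCharacterTwo.even_ringHomComp_iff ψF ι₂.injective, hψF]; exact hψe
  -- the elements `ξ`, `ξ′` at the level of `χ`
  obtain ⟨iM, hiM⟩ := hsd n hkn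
  obtain ⟨xT, hxT⟩ : ∃ s : CyclotomicField (cycLevel 2 (n + 2) ∅) ℚ,
      s = x' (n + 2) (cyclotomicLevelsRat 2 (badPlaces c d A N')).idealOne := ⟨_, rfl⟩
  set ξ : CyclotomicField (cycLevel 2 (n + 2) ∅) ℚ := ∑ b : (ZMod (cycLevel 2 (n + 2) ∅))ˣ,
    ψF (b : ZMod (cycLevel 2 (n + 2) ∅)) * sigma (cycLevel 2 (n + 2) ∅) b
      (x (n + 2) (cyclotomicLevelsRat 2 (badPlaces c d A N)).idealOne) with hξdef
  set ξ' : CyclotomicField (cycLevel 2 (n + 2) ∅) ℚ := ∑ b : (ZMod (cycLevel 2 (n + 2) ∅))ˣ,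
    ψF (b : ZMod (cycLevel 2 (n + 2) ∅)) * sigma (cycLevel 2 (n + 2) ∅) b (iM * xT) with hξ'def
  -- the pair value law at this level, and the ratio `ξ′ = τ(ρ₀) · ξ`
  have hval : CW * ι (cycLevel 2 (n + 2) ∅) ξ' = CT * ι (cycLevel 2 (n + 2) ∅) ξ :=
    hpair n hkn hiM ψF hψFe xT hxT
  obtain ⟨τ, hτ⟩ := exists_ringHom_cyclotomicField_comp_eq hdvd₀ (ι (cycLevel 2 (B + 2) ∅)) (ι (cycLevel 2 (n + 2) ∅))
  have hratio : ξ' = τ ρ₀ * ξ := by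
    apply (ι (cycLevel 2 (n + 2) ∅)).injective
    rw [map_mul, hτ]
    have h1 : CW * ι (cycLevel 2 (n + 2) ∅) ξ' = CW * (ι (cycLevel 2 (B + 2) ∅) ρ₀ * ι (cycLevel 2 (n + 2) ∅) ξ) := by
      rw [hval, ← hιρ₀]; ring
    exact mul_left_cancel₀ hCW0 h1
  -- the values of `w` on `proj_n y` and `proj_n ỹ`
  have hvalY := hw3 (z (n + 2) (cyclotomicLevelsRat 2 (badPlaces c d A N)).idealOne)
    (x (n + 2) (cyclotomicLevelsRat 2 (badPlaces c d A N)).idealOne)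
    (hbody.2.2.2.2.1 (n + 2) (cyclotomicLevelsRat 2 (badPlaces c d A N)).idealOne) hχU
  have hC4T : Λ' (n + 2) ∅ (z' (n + 2) (cyclotomicLevelsRat 2 (badPlaces c d A N')).idealOne) = (1 : ℚ_[2]) ⊗ₜ[ℚ] xT := by
    rw [hxT]; exact hbody'.2.2.2.2.1 (n + 2) (cyclotomicLevelsRat 2 (badPlaces c d A N')).idealOne
  have hΛT : Λ (n + 2) ∅ (twistH1On W A' u hu (hV (n + 2) hkn ∅)
      (z' (n + 2) (cyclotomicLevelsRat 2 (badPlaces c d A N')).idealOne)) = (1 : ℚ_[2]) ⊗ₜ[ℚ] (iM * xT) := by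
    rw [hlink (n + 2) hkn ∅ iM hiM, hC4T, Algebra.TensorProduct.tmul_mul_tmul, one_mul]
  have hvalT := hw3 (twistH1On W A' u hu (hV (n + 2) hkn ∅)
      (z' (n + 2) (cyclotomicLevelsRat 2 (badPlaces c d A N')).idealOne)) (iM * xT) hΛT hχU
  have hιξ : ι₂ ξ = ∑ b : (ZMod (cycLevel 2 (n + 2) ∅))ˣ, ψ (b : ZMod (cycLevel 2 (n + 2) ∅)) *
      ι₂ (sigma (cycLevel 2 (n + 2) ∅) b (x (n + 2) (cyclotomicLevelsRat 2 (badPlaces c d A N)).idealOne)) := by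
    rw [hξdef, map_sum]
    refine Finset.sum_congr rfl fun b _ ↦ ?_
    rw [map_mul, ← hψF, MulChar.ringHomComp_apply]
  have hιξ' : ι₂ ξ' = ∑ b : (ZMod (cycLevel 2 (n + 2) ∅))ˣ, ψ (b : ZMod (cycLevel 2 (n + 2) ∅)) *
      ι₂ (sigma (cycLevel 2 (n + 2) ∅) b (iM * xT)) := by
    rw [hξ'def, map_sum]
    refine Finset.sum_congr rfl fun b _ ↦ ?_
    rw [map_mul, ← hψF, MulChar.ringHomComp_apply]
  have hprojY : w (I.proj n y) =
      (Fintype.card (K.layerSubgroup n ⧸ (cycSubgroup 2 (n + 2) ∅).subgroupOf (K.layerSubgroup n)) : ℂ_[2]) * ι₂ ξ := by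
    rw [hy n, hιξ]
    unfold levelToLayerTwo
    exact hvalY
  have hprojT : w (I.proj n y') =
      (Fintype.card (K.layerSubgroup n ⧸ (cycSubgroup 2 (n + 2) ∅).subgroupOf (K.layerSubgroup n)) : ℂ_[2]) * ι₂ ξ' := by
    rw [hy' n hkn, hιξ']
    unfold levelToLayerTwo
    exact hvalT
  refine ⟨n, w, ?_, hw1, fun v ↦ ?_, ?_, ι₂ (τ ρ₀), hPmem (ι₂.comp τ), ?_⟩
  · -- `χ(γ₀)^{2^n} = 1` (`5` has order `2^n` mod `2^{n+2}`)
    rw [cyclotomicGenerator_two, ← map_pow,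
      show ((5 : ℕ) : ZMod (2 ^ (n + 2))) ^ 2 ^ n = 1 by rw [Nat.cast_ofNat, ← ZMod.orderOf_five n, pow_orderOf_eq_one], map_one]
  · -- eigenvalue `ψ(u)⁻¹ = χ(γ₀)`
    rw [hw2 γ v, hψu, inv_inv]
  · -- `w(proj_n y) ≠ 0`
    rw [hprojY, hιξ]
    refine mul_ne_zero (by exact_mod_cast Fintype.card_ne_zero) ?_
    exact sum_character_embed_sigma_ne_zero_of_rohrlich_two hbody hf hκ hA hc hd hcA hdA hc1 hd1 ha hB n hBn ι₂ ψ hψe hψp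
  · -- `w(proj_n ỹ) = ι₂(τ ρ₀) · w(proj_n y)`
    rw [hprojT, hprojY, hratio, map_mul]
    ring

end Assembly

end Literature.NumberTheory.EllipticCurves.Kato2004

end
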